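import Summits.HodgeConjecture.CorCM.Census.QuaternionColumnLaw
import Summits.HodgeConjecture.CorCM.Census.TwoAdicSplittingTraceResidual

/-!
# The quaternion column, even level: `μ(Q_{4n}, c) = φ₂(Q_{4n}, c)` for EVERY even `n ≥ 4` modulo fibre-independence and ONE mod-`2` statement

COR-CM (cell `pub-hodgecm2`), count-neutral kernel combinatorics by the binder seat b09 (gen 40; lane RELATIVE SPLITTING, part V = its consumer in the
lane QUATERNION COLUMN of gen 39), on `Census/QuaternionColumnLaw.lean` (gen 39: `nondegenerate_base`, and through it parts I–VI: `qfam`, `toward_off`,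
`par_qfam_eq_zero_of_far`, `residual_reduction_quaternion` — all stated for GENERAL `n`), `Census/BaseBlockCoveringOn.lean` (`exists_joint_cover_on`,
`toward_all_of_on`, `hcov_of_toward`), `Census/NondegenerateReduction.lean` (`reduction_of_residual`, `two_pow_smul_mem_psp_of_reduction`) and the
GROUP-FREE residual criterion `Splitting.isLeast_card_gfaces_generate_of_cover_of_supported` (`Census/TwoAdicSplittingTraceResidual.lean`, gen 40),
all BY NAME.  Theorems only: no definition, no `decide`, no certificate, no named fact, no `sorry`.
HONEST FRAMING: `HC_CM` is NOT proved, here or anywhere in the tree; nothing here is a period or a headline.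

**THEOREM (`isLeast_card_gfaces_generate_of_indep_of_residual`).**  Let `n ≥ 4` be EVEN (no `2`-power hypothesis) and suppose
* (I) gen 39ʼs explicit family `qfam n` (`5n − 9` faces) is FIBRE-INDEPENDENT, and
* (R) RESIDUAL GENERATION MOD `2`: every Hodge vector mod `2` supported on the residual types of `T₀ = barc 0 0` (potential `≤ 1`: the base changes of
  `T₀` and of its single flips, `2n − 1` blocks) lies in `pair2 + 𝔽₂⟨base changes of red (qfam n)⟩`.
Then the least number of face relations whose base changes generate the Hodge lattice of `(Q_{4n}, c)` modulo pairs is EXACTLY `φ₂(Q_{4n}, c)`: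
**`μ(Q_{4n}, c) = φ₂(Q_{4n}, c)`**.  For `n = 2^m` gen 39 proved (I) (`qfam_fibreIndep`) and did not need (R) (the `2`-group Nakayama,
`Census/QuaternionColumnPivot.lean`); for general even `n` the group `Q_{4n}` is not a `2`-group and (R) REPLACES Nakayama through the group-free
criterion — no Sylow subgroup, no factorisation, no trace is needed.  Numerically (gen 40, `HOME/pub-hodgecm2-b09/lean-g40/RELATIVE-SPLITTING.md` (4)):
(R) holds for `Q₁₆` (`48/48`) and for `Q₂₄` (`120/120`, the first non-`2`-power level, where also (I) holds: rank `172 = φ₂ = β` with the cover), so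
`μ(Q₂₄) = 172` — lit-andre-3ʼs certificate row `Census/TwentyFourDicyclic*` — is an instance of the uniform mechanism.

PROOF.  As in gen 39ʼs `isLeast_card_gfaces_generate_of_indep`: the generic joint cover `S₂` of the far blocks off `blkA ∪ blkB ∪ blkC` keeps fibre
independence and gives, with `toward_off`, a `toward` face through every type of potential `≥ 2`, hence the covering hypothesis (`hcov_of_toward`);
`residual_reduction_quaternion` (`k = 1`) and the nondegenerate base type give `2 · hodgeSpan ⊆ ℤ⟨pairs⟩ + ℤ[G]·S` (`reduction_of_residual`,
`two_pow_smul_mem_psp_of_reduction`); (R) is monotone in the family; the group-free criterion concludes, fibre independence of `S = qfam ∪ S₂` only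
COUNTING `|S| ≤ φ₂`.

## References
* [Pohlmann1968] H. Pohlmann, Algebraic cycles on abelian varieties of complex multiplication type, Ann. of Math. 88 (1968), Thm 1.
* [Milne1999] J. S. Milne, Lefschetz motives and the Tate conjecture, Compositio Math. 117 (1999), Prop. 2.1, p. 54.
-/

namespace Summit.HodgeConjecture.CorCM.Census.QuaternionColumn

open Finset QuaternionGroup
open Summit.HodgeConjecture.CorCM.Prior.AllgGroup.RfwfAllgGroup
open Summit.HodgeConjecture.CorCM.Census.BlockParity
open Summit.HodgeConjecture.CorCM.Census.Coinvariant
open Summit.HodgeConjecture.CorCM.Census.Nondegenerate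
open Summit.HodgeConjecture.CorCM.Census.Splitting
open Summit.HodgeConjecture.CorCM.Census.BaseBlock
open Summit.HodgeConjecture.CorCM.Census.TwistGeneration

noncomputable section

variable {n : ℕ} [NeZero n]

/-- **THE QUATERNION LAW AT EVEN LEVEL, modulo fibre-independence of `qfam` and residual generation mod `2`.**  For EVEN `n ≥ 4`: if gen 39ʼs explicit
family `qfam n` is fibre-independent and its target mod `2` contains every Hodge vector mod `2` supported on the residual types of `T₀ = barc 0 0`, then
`μ(Q_{4n}, c) = φ₂(Q_{4n}, c)`. [folklore] -/
theorem isLeast_card_gfaces_generate_of_indep_of_residual (heven : Even n) (h4 : 4 ≤ n)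
    (hli : LinearIndepOn (ZMod 2) (fun f : CMF (QuaternionGroup n) (c n) →₀ ℤ => (rad2 (c n) c_mul_c).mkQ (red (c n) f)) ↑(qfam n))
    (hres : ∀ y ∈ hodge2 (c n) c_mul_c,
      y ∈ Finsupp.supported (ZMod 2) (ZMod 2) {Ψ : CMF (QuaternionGroup n) (c n) | bpot (c n) (barc 0 0) Ψ ≤ 1} →
        y ∈ pair2 (c n) ⊔ Submodule.span (ZMod 2) (translates2 (c n) ((qfam n).image (red (c n))))) :
    IsLeast {k : ℕ | ∃ S : Finset (CMF (QuaternionGroup n) (c n) →₀ ℤ), (↑S ⊆ gfaceSet (QuaternionGroup n) (c n) c_mul_c) ∧ S.card = k ∧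
      hodgeSpan (c n) c_mul_c ≤ Submodule.span ℤ (pairSet (c n)) ⊔ Submodule.span ℤ (translates (c n) S)} (fibreTwo (c n) c_mul_c) := by
  classical
  -- the far set: blocks of potential `≥ 2` not covered explicitly
  set far : Block (c n) → Prop := fun B => 2 ≤ bpot (c n) (barc 0 0) B.out ∧ B ∉ blkA n ∪ blkB n ∪ blkC n with hfar
  obtain ⟨S₂, hS₂, -, -, hliU, -, htow⟩ := exists_joint_cover_on (c n) (barc 0 0) c_mul_c far (fun B hB => hB.1) (qfam n) hli
    (fun f hf B hB => par_qfam_eq_zero_of_far h4 hf B hB)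
  set S := qfam n ∪ S₂ with hSdef
  have hqS : qfam n ⊆ S := subset_union_left
  have hSsub : (↑S : Set (CMF (QuaternionGroup n) (c n) →₀ ℤ)) ⊆ gfaceSet (QuaternionGroup n) (c n) c_mul_c := by
    rw [hSdef, coe_union]; exact Set.union_subset (qfam_subset_gfaceSet (by omega)) hS₂
  -- the `toward` property through every type of potential `≥ 2`
  have hL : ∀ Φ : CMF (QuaternionGroup n) (c n), 2 ≤ bpot (c n) (barc 0 0) Φ →
      ∃ Q t t' : QuaternionGroup n, bpot (c n) (barc 0 0) Φ = ddist (rt (c n) Q (barc 0 0)) Φ ∧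
        t ∈ (rt (c n) Q (barc 0 0)).1 \ Φ.1 ∧ t' ∈ (rt (c n) Q (barc 0 0)).1 \ Φ.1 ∧ t ≠ t' ∧
          gface (c n) c_mul_c Φ t t' ∈ Submodule.span ℤ (pairSet (c n)) ⊔ Submodule.span ℤ (translates (c n) S) := by
    refine toward_all_of_on (c n) (barc 0 0) c_mul_c far _ (fun Φ hΦ => htow _ ?_ Φ hΦ) (fun Φ hΦ hnot => ?_)
    · refine (Submodule.span_mono ?_).trans le_sup_right
      rintro _ ⟨Q, s, hs, rfl⟩
      exact ⟨Q, s, mem_union_right _ hs, rfl⟩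
    · have hX : blk (c n) Φ ∈ blkA n ∪ blkB n ∪ blkC n := by
        by_contra h
        exact hnot ⟨by rw [bpot_out]; exact hΦ, h⟩
      exact toward_off heven h4 S hqS Φ hX
  have hcov := hcov_of_toward (c n) (barc 0 0) c_mul_c S hL
  -- `k = 1`: the residual reduction of gen 39 and the nondegenerate base type
  have hresk := residual_reduction_quaternion S (fun k hk => hqS (fplus_mem_qfam k hk)) (fun i h1 h2 => hqS (f_mem_qfam i h1 h2))
    (fun i h1 h2 => hqS (c_mem_qfam i h1 h2)) (fun j h1 h2 => hqS (f'_mem_qfam j h1 h2)) (fun j h1 h3 => hqS (c'_mem_qfam j h1 h3))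
  have htwo := two_pow_smul_mem_psp_of_reduction (c n) c_mul_c c_comm (barc 0 0) nondegenerate_base S
    (hSsub.trans (gfaceSet_subset_hodgeSpan (c n) c_mul_c)) 1
    (reduction_of_residual (c n) (barc 0 0) _ {Ψ : CMF (QuaternionGroup n) (c n) | bpot (c n) (barc 0 0) Ψ ≤ 1} 1 hcov
      (fun Ψ hΨ => hresk Ψ hΨ))
  -- residual generation mod `2` is monotone in the family
  have hres' : ∀ y ∈ hodge2 (c n) c_mul_c,
      y ∈ Finsupp.supported (ZMod 2) (ZMod 2) {Ψ : CMF (QuaternionGroup n) (c n) | bpot (c n) (barc 0 0) Ψ ≤ 1} →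
        y ∈ pair2 (c n) ⊔ Submodule.span (ZMod 2) (translates2 (c n) (S.image (red (c n)))) :=
    fun y hy hyR => cobdry_mono (c n) hqS (hres y hy hyR)
  exact (isLeast_card_gfaces_generate_of_cover_of_supported (c n) c_mul_c c_ne_one c_comm S hSsub hliU
    {Ψ : CMF (QuaternionGroup n) (c n) | bpot (c n) (barc 0 0) Ψ ≤ 1} hcov hres' 1 htwo).2

/-- **The generating family has EXACTLY `φ₂` members and contains `qfam`** (existence form, same hypotheses). [folklore] -/
theorem exists_generate_card_eq_fibreTwo_of_indep_of_residual (heven : Even n) (h4 : 4 ≤ n)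
    (hli : LinearIndepOn (ZMod 2) (fun f : CMF (QuaternionGroup n) (c n) →₀ ℤ => (rad2 (c n) c_mul_c).mkQ (red (c n) f)) ↑(qfam n))
    (hres : ∀ y ∈ hodge2 (c n) c_mul_c,
      y ∈ Finsupp.supported (ZMod 2) (ZMod 2) {Ψ : CMF (QuaternionGroup n) (c n) | bpot (c n) (barc 0 0) Ψ ≤ 1} →
        y ∈ pair2 (c n) ⊔ Submodule.span (ZMod 2) (translates2 (c n) ((qfam n).image (red (c n))))) :
    ∃ S : Finset (CMF (QuaternionGroup n) (c n) →₀ ℤ), qfam n ⊆ S ∧ (↑S ⊆ gfaceSet (QuaternionGroup n) (c n) c_mul_c) ∧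
      S.card = fibreTwo (c n) c_mul_c ∧
        hodgeSpan (c n) c_mul_c ≤ Submodule.span ℤ (pairSet (c n)) ⊔ Submodule.span ℤ (translates (c n) S) := by
  classical
  set far : Block (c n) → Prop := fun B => 2 ≤ bpot (c n) (barc 0 0) B.out ∧ B ∉ blkA n ∪ blkB n ∪ blkC n with hfar
  obtain ⟨S₂, hS₂, -, -, hliU, -, htow⟩ := exists_joint_cover_on (c n) (barc 0 0) c_mul_c far (fun B hB => hB.1) (qfam n) hli
    (fun f hf B hB => par_qfam_eq_zero_of_far h4 hf B hB)
  set S := qfam n ∪ S₂ with hSdef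
  have hqS : qfam n ⊆ S := subset_union_left
  have hSsub : (↑S : Set (CMF (QuaternionGroup n) (c n) →₀ ℤ)) ⊆ gfaceSet (QuaternionGroup n) (c n) c_mul_c := by
    rw [hSdef, coe_union]; exact Set.union_subset (qfam_subset_gfaceSet (by omega)) hS₂
  have hL : ∀ Φ : CMF (QuaternionGroup n) (c n), 2 ≤ bpot (c n) (barc 0 0) Φ →
      ∃ Q t t' : QuaternionGroup n, bpot (c n) (barc 0 0) Φ = ddist (rt (c n) Q (barc 0 0)) Φ ∧
        t ∈ (rt (c n) Q (barc 0 0)).1 \ Φ.1 ∧ t' ∈ (rt (c n) Q (barc 0 0)).1 \ Φ.1 ∧ t ≠ t' ∧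
          gface (c n) c_mul_c Φ t t' ∈ Submodule.span ℤ (pairSet (c n)) ⊔ Submodule.span ℤ (translates (c n) S) := by
    refine toward_all_of_on (c n) (barc 0 0) c_mul_c far _ (fun Φ hΦ => htow _ ?_ Φ hΦ) (fun Φ hΦ hnot => ?_)
    · refine (Submodule.span_mono ?_).trans le_sup_right
      rintro _ ⟨Q, s, hs, rfl⟩
      exact ⟨Q, s, mem_union_right _ hs, rfl⟩
    · have hX : blk (c n) Φ ∈ blkA n ∪ blkB n ∪ blkC n := by
        by_contra h
        exact hnot ⟨by rw [bpot_out]; exact hΦ, h⟩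
      exact toward_off heven h4 S hqS Φ hX
  have hcov := hcov_of_toward (c n) (barc 0 0) c_mul_c S hL
  have hresk := residual_reduction_quaternion S (fun k hk => hqS (fplus_mem_qfam k hk)) (fun i h1 h2 => hqS (f_mem_qfam i h1 h2))
    (fun i h1 h2 => hqS (c_mem_qfam i h1 h2)) (fun j h1 h2 => hqS (f'_mem_qfam j h1 h2)) (fun j h1 h3 => hqS (c'_mem_qfam j h1 h3))
  have htwo := two_pow_smul_mem_psp_of_reduction (c n) c_mul_c c_comm (barc 0 0) nondegenerate_base S
    (hSsub.trans (gfaceSet_subset_hodgeSpan (c n) c_mul_c)) 1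
    (reduction_of_residual (c n) (barc 0 0) _ {Ψ : CMF (QuaternionGroup n) (c n) | bpot (c n) (barc 0 0) Ψ ≤ 1} 1 hcov
      (fun Ψ hΨ => hresk Ψ hΨ))
  have hres' : ∀ y ∈ hodge2 (c n) c_mul_c,
      y ∈ Finsupp.supported (ZMod 2) (ZMod 2) {Ψ : CMF (QuaternionGroup n) (c n) | bpot (c n) (barc 0 0) Ψ ≤ 1} →
        y ∈ pair2 (c n) ⊔ Submodule.span (ZMod 2) (translates2 (c n) (S.image (red (c n)))) :=
    fun y hy hyR => cobdry_mono (c n) hqS (hres y hy hyR)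
  have hgen := hodgeSpan_le_of_cover_of_supported (c n) c_mul_c c_ne_one c_comm S (hSsub.trans (gfaceSet_subset_hodgeSpan (c n) c_mul_c))
    {Ψ : CMF (QuaternionGroup n) (c n) | bpot (c n) (barc 0 0) Ψ ≤ 1} hcov hres' 1 htwo
  exact ⟨S, hqS, hSsub, (isLeast_card_gfaces_generate_of_cover_of_supported (c n) c_mul_c c_ne_one c_comm S hSsub hliU
    {Ψ : CMF (QuaternionGroup n) (c n) | bpot (c n) (barc 0 0) Ψ ≤ 1} hcov hres' 1 htwo).1, hgen⟩

end

end Summit.HodgeConjecture.CorCM.Census.QuaternionColumn
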